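import Mathlib
import Summits.Ventures.PercRepro2.CoinChainPivotalMean

/-!
# The universal PURE chain from the WORLD-0 corner of the mixed-centre family
(blind cell PercRepro2, night-2 g23; proofs/NIGHT2-DARC.md §63.3)

The mixed-centre family `∑_{G¹}(x − p_{ρ₁})(y − q_{ρ₂}) ≥ 0` is bilinear in its two centre
parameters, so it is exactly its four corners; `CoinChainPivotalMean` used the corners
`(1, 0)` and `(0, 1)`.  This file uses the corner `(0, 0)` — the world-1 gate centred at the
WORLD-0 means, `U001 = a0² g12 − a0 a2 g1 − a0 a1 g2 + a1 a2 g0 ≥ 0` — through the ring identity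

  `a0²·U111 + (b0 − g0)·Δ = b0²·U001 + a0·E'·(b0 g1 − b1 g0) + a0·E·(b0 g2 − b2 g0) + E·E'·(b0 − 2 g0)`

(`E = b0 a1 − a0 b1`, `E' = b0 a2 − a0 b2`, `Δ = E E'`): (Q′) holds whenever
`a0·(E'·(b0 g1 − b1 g0) + E·(b0 g2 − b2 g0)) + E E'·(b0 − 2 g0) ≥ 0` — in the anti-aligned
pattern, whenever the gate keeps at least half of the world-1 mass and the two gate excesses
`A = g1 − p₁ g0`, `B = g2 − q₁ g0` are not too large against the world shifts
(`φ A + ε B ≤ |εφ|·(2 g0 − b0)`).  THEOREMS: `pureChain_functional_nonneg_of_world0Corner`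
(the pure chain at EVERY `ρ ∈ [0, 1]`, general increasing markers) and
`darc_of_pureChain_of_world0Corner` (row 2′DARC at the pure chain, point markers).
-/

namespace Summit.Ventures.PercRepro2.Coin

open Classical

section World0CornerAlg

variable {R : Type*} [CommRing R]

/-- **The identity behind the world-0 corner.** -/
lemma qprime_world0_identity (a0 a1 a2 b0 b1 b2 g0 g1 g2 g12 : R) :
    a0 ^ 2 * (b0 * b0 * g12 - b0 * b2 * g1 - b0 * b1 * g2 + b1 * b2 * g0)
      + (b0 - g0) * ((b0 * a1 - a0 * b1) * (b0 * a2 - a0 * b2))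
    = b0 ^ 2 * (a0 * a0 * g12 - a0 * a2 * g1 - a0 * a1 * g2 + a1 * a2 * g0)
      + (a0 * ((b0 * a2 - a0 * b2) * (b0 * g1 - b1 * g0) + (b0 * a1 - a0 * b1) * (b0 * g2 - b2 * g0))
        + (b0 * a1 - a0 * b1) * (b0 * a2 - a0 * b2) * (b0 - 2 * g0)) := by ring

end World0CornerAlg

section World0CornerOrd

variable {R : Type*} [Field R] [LinearOrder R] [IsStrictOrderedRing R]

/-- (Q′) from `U001 ≥ 0` and the world-0 corner sign condition. -/
lemma qprime_of_world0Corner_alg (a0 a1 a2 b0 b1 b2 g0 g1 g2 g12 : R)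
    (hU001 : 0 ≤ a0 * a0 * g12 - a0 * a2 * g1 - a0 * a1 * g2 + a1 * a2 * g0)
    (hsign : 0 ≤ a0 * ((b0 * a2 - a0 * b2) * (b0 * g1 - b1 * g0) + (b0 * a1 - a0 * b1) * (b0 * g2 - b2 * g0))
        + (b0 * a1 - a0 * b1) * (b0 * a2 - a0 * b2) * (b0 - 2 * g0)) :
    0 ≤ a0 ^ 2 * (b0 * b0 * g12 - b0 * b2 * g1 - b0 * b1 * g2 + b1 * b2 * g0)
      + (b0 - g0) * ((b0 * a1 - a0 * b1) * (b0 * a2 - a0 * b2)) := by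
  rw [qprime_world0_identity]
  have h1 : 0 ≤ b0 ^ 2 * (a0 * a0 * g12 - a0 * a2 * g1 - a0 * a1 * g2 + a1 * a2 * g0) :=
    mul_nonneg (sq_nonneg b0) hU001
  linarith

end World0CornerOrd

section World0CornerMain

variable {V : Type*} [DecidableEq V] {R : Type*} [Field R] [LinearOrder R] [IsStrictOrderedRing R]

/-- **THE UNIVERSAL PURE CHAIN FROM THE WORLD-0 CORNER.** Notation as in
`pureChain_functional_nonneg_of_pivotalX`; under the head hypotheses and positive world masses,
the sign condition `a0·(E'·(b0 g1 − b1 g0) + E·(b0 g2 − b2 g0)) + E E'·(b0 − 2 g0) ≥ 0` implies the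
pure chain functional at EVERY `ρ ∈ [0, 1]` for every pair of nonnegative increasing markers. -/
theorem pureChain_functional_nonneg_of_world0Corner (U ent' : Finset V) (ν c d d' : Finset V → R)
    (ρ : R) (hρ0 : 0 ≤ ρ) (hρ1 : ρ ≤ 1) (hν0 : ∀ W, 0 ≤ ν W)
    (hν : ∀ s ⊆ U, ∀ t ⊆ U, ν s * ν t ≤ ν (s ∩ t) * ν (s ∪ t))
    (hc0 : ∀ W, 0 ≤ c W) (hd0 : ∀ W, 0 ≤ d W) (hd'0 : ∀ W, 0 ≤ d' W)
    (hdc : ∀ W, d W ≤ c W) (hd'c : ∀ W, d' W ≤ c W)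
    (hcc : ∀ s t, c s * c t ≤ c (s ∩ t) * c (s ∪ t))
    (hdd : ∀ s t, d s * d t ≤ d (s ∩ t) * d (s ∪ t))
    (hd'd' : ∀ s t, d' s * d' t ≤ d' (s ∩ t) * d' (s ∪ t))
    (hcd : ∀ s t, c s * d t ≤ c (s ∩ t) * d (s ∪ t))
    (hcd' : ∀ s t, c s * d' t ≤ c (s ∩ t) * d' (s ∪ t))
    (hdd' : ∀ s t, d s * d' t ≤ d (s ∩ t) * d' (s ∪ t))
    (hratio : ∀ s t, s ⊆ t → d s * c t ≤ c s * d t)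
    (hratio' : ∀ s t, s ⊆ t → d' s * c t ≤ c s * d' t)
    (x y : Finset V → R) (hx0 : ∀ W, 0 ≤ x W) (hy0 : ∀ W, 0 ≤ y W)
    (hxm : ∀ s t, x s ≤ x (s ∪ t)) (hym : ∀ s t, y s ≤ y (s ∪ t))
    (hpos0 : 0 < ∑ W ∈ U.powerset, ν W * c W)
    (hpos1 : 0 < ∑ W ∈ U.powerset, ν W * chainMix ∅ ent' 1 c d W)
    (hsign : 0 ≤ (∑ W ∈ U.powerset, ν W * c W) *
        (((∑ W ∈ U.powerset, ν W * chainMix ∅ ent' 1 c d W) * (∑ W ∈ U.powerset, ν W * c W * y W)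
            - (∑ W ∈ U.powerset, ν W * c W) * (∑ W ∈ U.powerset, ν W * chainMix ∅ ent' 1 c d W * y W)) *
          ((∑ W ∈ U.powerset, ν W * chainMix ∅ ent' 1 c d W) *
              (∑ W ∈ U.powerset, ν W * chainMix ∅ ent' 1 c d' W * x W)
            - (∑ W ∈ U.powerset, ν W * chainMix ∅ ent' 1 c d W * x W) *
              (∑ W ∈ U.powerset, ν W * chainMix ∅ ent' 1 c d' W))
        + ((∑ W ∈ U.powerset, ν W * chainMix ∅ ent' 1 c d W) * (∑ W ∈ U.powerset, ν W * c W * x W)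
            - (∑ W ∈ U.powerset, ν W * c W) * (∑ W ∈ U.powerset, ν W * chainMix ∅ ent' 1 c d W * x W)) *
          ((∑ W ∈ U.powerset, ν W * chainMix ∅ ent' 1 c d W) *
              (∑ W ∈ U.powerset, ν W * chainMix ∅ ent' 1 c d' W * y W)
            - (∑ W ∈ U.powerset, ν W * chainMix ∅ ent' 1 c d W * y W) *
              (∑ W ∈ U.powerset, ν W * chainMix ∅ ent' 1 c d' W)))
        + ((∑ W ∈ U.powerset, ν W * chainMix ∅ ent' 1 c d W) * (∑ W ∈ U.powerset, ν W * c W * x W)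
            - (∑ W ∈ U.powerset, ν W * c W) * (∑ W ∈ U.powerset, ν W * chainMix ∅ ent' 1 c d W * x W)) *
          ((∑ W ∈ U.powerset, ν W * chainMix ∅ ent' 1 c d W) * (∑ W ∈ U.powerset, ν W * c W * y W)
            - (∑ W ∈ U.powerset, ν W * c W) * (∑ W ∈ U.powerset, ν W * chainMix ∅ ent' 1 c d W * y W)) *
          ((∑ W ∈ U.powerset, ν W * chainMix ∅ ent' 1 c d W)
            - 2 * (∑ W ∈ U.powerset, ν W * chainMix ∅ ent' 1 c d' W))) :
    0 ≤ (∑ W ∈ U.powerset, ν W * chainMix ∅ ent' ρ c d W) ^ 2 *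
          (∑ W ∈ U.powerset, ν W * chainMix ∅ ent' ρ c d' W * (x W * y W))
        - (∑ W ∈ U.powerset, ν W * chainMix ∅ ent' ρ c d W) *
          (∑ W ∈ U.powerset, ν W * chainMix ∅ ent' ρ c d W * x W) *
          (∑ W ∈ U.powerset, ν W * chainMix ∅ ent' ρ c d' W * y W)
        - (∑ W ∈ U.powerset, ν W * chainMix ∅ ent' ρ c d W) *
          (∑ W ∈ U.powerset, ν W * chainMix ∅ ent' ρ c d W * y W) *
          (∑ W ∈ U.powerset, ν W * chainMix ∅ ent' ρ c d' W * x W)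
        + (∑ W ∈ U.powerset, ν W * chainMix ∅ ent' ρ c d W * x W) *
          (∑ W ∈ U.powerset, ν W * chainMix ∅ ent' ρ c d W * y W) *
          (∑ W ∈ U.powerset, ν W * chainMix ∅ ent' ρ c d' W) := by
  have hU001 := chain_world1_mixed_nonneg U ∅ ent' ν c d d' 0 0 le_rfl zero_le_one le_rfl
    zero_le_one hν0 hν hc0 hd0 hd'0 hdc hd'c hcc hdd hd'd' hcd hcd' hdd' hratio hratio' x y hx0 hy0 hxm hym
  simp only [chainMix_zero_empty] at hU001
  have hQ := qprime_of_world0Corner_alg _ _ _ _ _ _ _ _ _ _ hU001 hsign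
  exact pureChain_functional_nonneg_of_Qprime U ent' ν c d d' ρ hρ0 hρ1 hν0 hν hc0 hd0 hd'0 hdc hd'c
    hcc hdd hd'd' hcd hcd' hdd' hratio hratio' x y hx0 hy0 hxm hym hpos0 hpos1 hQ

end World0CornerMain

section World0CornerDarc

variable {V : Type*} {E : Type*} [Fintype V] [DecidableEq V] [Fintype E] [DecidableEq E]
  {R : Type*} [Field R] [LinearOrder R] [IsStrictOrderedRing R]
  {arcs : E → Finset (V × V)} {s : V} {U : Finset V} {ent' : Finset V} {c' : V → E}
  {a' a w : V} {c : V → E}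

/-- **ROW 2′DARC AT THE PURE AND-SWITCH CHAIN FROM THE WORLD-0 CORNER** (chain data, point
markers `m₁, m₂`, positive world masses, the sign condition of
`pureChain_functional_nonneg_of_world0Corner` on the chain data). -/
theorem darc_of_pureChain_of_world0Corner (pr : E → R) (hp : IsProbVec pr) (hS : SameEnds arcs)
    (h' : OrTailK arcs s U ent' c' a') (hsure' : ∀ r ∈ ent', pr (c' r) = 1)
    (h : OrTailK arcs s (insert a' U) (insert a' ∅) c a)
    {m₁ m₂ : V} (hm₁ : m₁ ∈ U) (hm₂ : m₂ ∈ U)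
    (hν : ∀ W W', W ⊆ U → W' ⊆ U →
      prob pr (coreLevel arcs s U W) * prob pr (coreLevel arcs s U W') ≤
        prob pr (coreLevel arcs s U (W ∩ W')) * prob pr (coreLevel arcs s U (W ∪ W')))
    {t : V} (htC : t ∉ insert a (insert a' U)) (hts : t ≠ s) (hws : w ≠ s)
    (hwC : w ∉ insert a (insert a' U))
    (hpos0 : 0 < ∑ W ∈ U.powerset, prob pr (coreLevel arcs s U W) * chainC pr arcs s t U ent' a' a W)
    (hpos1 : 0 < ∑ W ∈ U.powerset, prob pr (coreLevel arcs s U W) *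
      chainMix ∅ ent' 1 (chainC pr arcs s t U ent' a' a) (chainD pr arcs s t U ent' a' a) W)
    (hsign : 0 ≤ (∑ W ∈ U.powerset, prob pr (coreLevel arcs s U W) * chainC pr arcs s t U ent' a' a W) *
        (((∑ W ∈ U.powerset, prob pr (coreLevel arcs s U W) *
              chainMix ∅ ent' 1 (chainC pr arcs s t U ent' a' a) (chainD pr arcs s t U ent' a' a) W) *
            (∑ W ∈ U.powerset, prob pr (coreLevel arcs s U W) * chainC pr arcs s t U ent' a' a W *
              (if m₂ ∈ W then (1 : R) else 0))
            - (∑ W ∈ U.powerset, prob pr (coreLevel arcs s U W) * chainC pr arcs s t U ent' a' a W) *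
            (∑ W ∈ U.powerset, prob pr (coreLevel arcs s U W) *
              chainMix ∅ ent' 1 (chainC pr arcs s t U ent' a' a) (chainD pr arcs s t U ent' a' a) W *
              (if m₂ ∈ W then (1 : R) else 0))) *
          ((∑ W ∈ U.powerset, prob pr (coreLevel arcs s U W) *
              chainMix ∅ ent' 1 (chainC pr arcs s t U ent' a' a) (chainD pr arcs s t U ent' a' a) W) *
              (∑ W ∈ U.powerset, prob pr (coreLevel arcs s U W) *
                chainMix ∅ ent' 1 (chainC pr arcs s t U ent' a' a) (chainD' pr arcs s t U ent' a' a w) W *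
                (if m₁ ∈ W then (1 : R) else 0))
            - (∑ W ∈ U.powerset, prob pr (coreLevel arcs s U W) *
                chainMix ∅ ent' 1 (chainC pr arcs s t U ent' a' a) (chainD pr arcs s t U ent' a' a) W *
                (if m₁ ∈ W then (1 : R) else 0)) *
              (∑ W ∈ U.powerset, prob pr (coreLevel arcs s U W) *
                chainMix ∅ ent' 1 (chainC pr arcs s t U ent' a' a) (chainD' pr arcs s t U ent' a' a w) W))
        + ((∑ W ∈ U.powerset, prob pr (coreLevel arcs s U W) *
              chainMix ∅ ent' 1 (chainC pr arcs s t U ent' a' a) (chainD pr arcs s t U ent' a' a) W) *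
            (∑ W ∈ U.powerset, prob pr (coreLevel arcs s U W) * chainC pr arcs s t U ent' a' a W *
              (if m₁ ∈ W then (1 : R) else 0))
            - (∑ W ∈ U.powerset, prob pr (coreLevel arcs s U W) * chainC pr arcs s t U ent' a' a W) *
            (∑ W ∈ U.powerset, prob pr (coreLevel arcs s U W) *
              chainMix ∅ ent' 1 (chainC pr arcs s t U ent' a' a) (chainD pr arcs s t U ent' a' a) W *
              (if m₁ ∈ W then (1 : R) else 0))) *
          ((∑ W ∈ U.powerset, prob pr (coreLevel arcs s U W) *
              chainMix ∅ ent' 1 (chainC pr arcs s t U ent' a' a) (chainD pr arcs s t U ent' a' a) W) *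
              (∑ W ∈ U.powerset, prob pr (coreLevel arcs s U W) *
                chainMix ∅ ent' 1 (chainC pr arcs s t U ent' a' a) (chainD' pr arcs s t U ent' a' a w) W *
                (if m₂ ∈ W then (1 : R) else 0))
            - (∑ W ∈ U.powerset, prob pr (coreLevel arcs s U W) *
                chainMix ∅ ent' 1 (chainC pr arcs s t U ent' a' a) (chainD pr arcs s t U ent' a' a) W *
                (if m₂ ∈ W then (1 : R) else 0)) *
              (∑ W ∈ U.powerset, prob pr (coreLevel arcs s U W) *
                chainMix ∅ ent' 1 (chainC pr arcs s t U ent' a' a) (chainD' pr arcs s t U ent' a' a w) W)))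
        + ((∑ W ∈ U.powerset, prob pr (coreLevel arcs s U W) *
              chainMix ∅ ent' 1 (chainC pr arcs s t U ent' a' a) (chainD pr arcs s t U ent' a' a) W) *
            (∑ W ∈ U.powerset, prob pr (coreLevel arcs s U W) * chainC pr arcs s t U ent' a' a W *
              (if m₁ ∈ W then (1 : R) else 0))
            - (∑ W ∈ U.powerset, prob pr (coreLevel arcs s U W) * chainC pr arcs s t U ent' a' a W) *
            (∑ W ∈ U.powerset, prob pr (coreLevel arcs s U W) *
              chainMix ∅ ent' 1 (chainC pr arcs s t U ent' a' a) (chainD pr arcs s t U ent' a' a) W *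
              (if m₁ ∈ W then (1 : R) else 0))) *
          ((∑ W ∈ U.powerset, prob pr (coreLevel arcs s U W) *
              chainMix ∅ ent' 1 (chainC pr arcs s t U ent' a' a) (chainD pr arcs s t U ent' a' a) W) *
            (∑ W ∈ U.powerset, prob pr (coreLevel arcs s U W) * chainC pr arcs s t U ent' a' a W *
              (if m₂ ∈ W then (1 : R) else 0))
            - (∑ W ∈ U.powerset, prob pr (coreLevel arcs s U W) * chainC pr arcs s t U ent' a' a W) *
            (∑ W ∈ U.powerset, prob pr (coreLevel arcs s U W) *
              chainMix ∅ ent' 1 (chainC pr arcs s t U ent' a' a) (chainD pr arcs s t U ent' a' a) W *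
              (if m₂ ∈ W then (1 : R) else 0))) *
          ((∑ W ∈ U.powerset, prob pr (coreLevel arcs s U W) *
              chainMix ∅ ent' 1 (chainC pr arcs s t U ent' a' a) (chainD pr arcs s t U ent' a' a) W)
            - 2 * (∑ W ∈ U.powerset, prob pr (coreLevel arcs s U W) *
              chainMix ∅ ent' 1 (chainC pr arcs s t U ent' a' a) (chainD' pr arcs s t U ent' a' a w) W))) :
    DARC pr arcs s {t} m₁ m₂ a w := by
  obtain ⟨hA0, hAmono, hAlsm⟩ := OrTailU.head_props (U := insert a' U) (a := a) pr hp hS t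
  obtain ⟨hdc, hd'd, hcc, hdd, hd'd', hdd', hratio, hratio', -, hcd, hcd'⟩ :=
    chainPhi_head_hyps (fun X => prob pr (coreAvoidEvent arcs s t (insert a (insert a' U)) X))
      ent' a' a w hA0 hAmono hAlsm
  have hx0 : ∀ W : Finset V, (0 : R) ≤ (if m₁ ∈ W then (1 : R) else 0) := by
    intro W; split_ifs <;> norm_num
  have hy0 : ∀ W : Finset V, (0 : R) ≤ (if m₂ ∈ W then (1 : R) else 0) := by
    intro W; split_ifs <;> norm_num
  have hxm : ∀ s t : Finset V,
      (if m₁ ∈ s then (1 : R) else 0) ≤ (if m₁ ∈ s ∪ t then (1 : R) else 0) := by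
    intro s t
    by_cases h : m₁ ∈ s
    · rw [if_pos h, if_pos (Finset.mem_union_left t h)]
    · rw [if_neg h]; split_ifs <;> norm_num
  have hym : ∀ s t : Finset V,
      (if m₂ ∈ s then (1 : R) else 0) ≤ (if m₂ ∈ s ∪ t then (1 : R) else 0) := by
    intro s t
    by_cases h : m₂ ∈ s
    · rw [if_pos h, if_pos (Finset.mem_union_left t h)]
    · rw [if_neg h]; split_ifs <;> norm_num
  refine chain_darc_of_functional pr hS h' hsure' h (by simp) (Finset.empty_subset _) hm₁ hm₂ htC hts hws hwC ?_
  exact pureChain_functional_nonneg_of_world0Corner U ent' (fun W => prob pr (coreLevel arcs s U W))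
    (chainC pr arcs s t U ent' a' a) (chainD pr arcs s t U ent' a' a) (chainD' pr arcs s t U ent' a' a w)
    (pr (c a')) (hp.nonneg _) (hp.le_one _) (fun W => prob_nonneg hp _)
    (fun s' hs' t' ht' => hν s' t' hs' ht') (fun W => hA0 _) (fun W => hA0 _) (fun W => hA0 _)
    hdc (fun W => le_trans (hd'd W) (hdc W)) hcc hdd hd'd' hcd hcd' hdd' hratio hratio'
    (fun W => if m₁ ∈ W then (1 : R) else 0) (fun W => if m₂ ∈ W then (1 : R) else 0)
    hx0 hy0 hxm hym hpos0 hpos1 hsign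

end World0CornerDarc

end Summit.Ventures.PercRepro2.Coin
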